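import Mathlib
import Summits.ValiantsHypothesis.ValiantsHypothesis.Theorems.FifoMatchingNNNotVPMonotoneProjection
import Summits.ValiantsHypothesis.ValiantsHypothesis.Theorems.FifoMatchingNNNotVPSupportFnMatchings
import Literature.Computability.Complexity.CliqueSqrtLowerBound
import Summits.ValiantsHypothesis.ValiantsHypothesis.Theorems.BarrierLeverSigmaLambdaSigmaSliceCertificate
import HarnessLib

/-!
# Route FifoMatching — crux `NNNotVP` (stmt-ValiantsHypothesis-11615), line `division_split`:
# stub A from a monotone PROJECTION of nest-free matching existence onto a clique-like function

Registered line `Cruxes/NNNotVP/Lines/division_split.lean`; objects `σ` / `NN` / `SuppFn` /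
`freeVars` = the line's vocabulary (`Theorems/FifoMatchingNNNotVPDivisionSplitDefs.lean`).

By `supportFnHard_iff_circuitSizeOver_lowerBound` (companion `…SupportFnOfMonotoneCircuit`) stub A
(`stub_supportFnHard`) IS a super-quasi-polynomial lower bound on `circuitSizeOver monotoneBasis` of
nest-free perfect-matching EXISTENCE on the ordered arc sets of `[2n]` (`x ↦ [SuppFn NN_n {e | x e}]`;
shuffle-square recognition, NP-complete).  The tree PROVES an exponential monotone lower bound for
every `(⌊√m⌋ - 1, ⌊√m⌋)`-clique-like function
(`Literature.Computability.Complexity.cliqueSqrt_monotone_lowerBound`: `≥ 2^{m^{1/8}}` gates,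
Alon–Boppana 1987 / Tardos 1988 / Jukna 2012 Thm. 9.26).  This file turns that theorem into a
REDUCTION PRINCIPLE for stub A: it now suffices to exhibit, for all large `n`, a MONOTONE PROJECTION
(each arc variable of `[2n]` is an edge variable of `K_m` or a constant) under which nest-free
perfect-matching existence becomes `(⌊√m⌋ - 1, ⌊√m⌋)`-clique-like, with `n ≤ m^{C₀}` — a pure
gadget-existence statement («NFPM-existence is hard for monotone NP under monotone projections»);
all complexity theory is discharged here.

* (companion `…MonotoneProjection`: `exists_monotoneCircuit_projection` — projections WITH
  CONSTANTS cost `≤ 2·|κ|` extra gates over `monotoneBasis`; `le_circuitSizeOver_of_forall`;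
  `exists_monotoneCircuit_nfpm`);
* `two_pow_polylog_add_lt` — the asymptotics `2^{(C₀(log₂ m + 1) + c)^c} + 2m² < 2^{m^{1/8}}`;
* `circuitSizeOver_lowerBound_of_cliqueProjection` — the `circuitSizeOver` form of stub A from the
  gadget hypothesis; `supportFnHard_of_cliqueProjection` — stub A VERBATIM from it.

Honest framing: a reduction; the projection (gadget) is NOT constructed here, stubs Z / A / B2, the
crux `NNNotVP` and `VP ≠ VNP` stay OPEN (NOT proved).  No definitions, no named facts.
-/

noncomputable section

-- Sub = Summit single-conjunct layout: the duplicated namespace component is mandated by the tree.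
set_option linter.dupNamespace false

namespace Summit.ValiantsHypothesis.ValiantsHypothesis.Theorems.FifoMatching.NNNotVP.DivisionSplit

open MvPolynomial Literature.Computability.AlgebraicComplexity
open Literature.Computability.Complexity
open Literature.Computability.Complexity.GateList
open Filter
open scoped NNReal BigOperators Classical

/-! ### Asymptotics: quasi-polynomial in `n ≤ m^{C₀}` against `2^{m^{1/8}}` -/

/-- The exponent bookkeeping: with `L = ⌊log₂ m⌋` and `q = ⌊L/8⌋`, for `q` large
`(C₀ (L + 1) + c)^c + 2L + 4 ≤ 2^q`. [folklore] -/
theorem polylog_exponent_le_two_pow (c C₀ : ℕ) :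
    ∃ Q : ℕ, ∀ q ≥ Q, ∀ L ≤ 8 * q + 7, (C₀ * (L + 1) + c) ^ c + 2 * L + 4 ≤ 2 ^ q := by
  set K : ℕ := (16 * C₀ + c) ^ c + 34 with hK
  refine ⟨max (max K (4 ^ (c + 2))) 1, fun q hq L hL => ?_⟩
  have hqK : K ≤ q := le_trans (le_max_left _ _) (le_trans (le_max_left _ _) hq)
  have hq4 : 4 ^ (c + 2) ≤ q := le_trans (le_max_right _ _) (le_trans (le_max_left _ _) hq)
  have hq1 : 1 ≤ q := le_trans (le_max_right _ _) hq
  -- `(C₀ (L+1) + c)^c ≤ ((16 C₀ + c) q)^c`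
  have hbase : C₀ * (L + 1) + c ≤ (16 * C₀ + c) * q := by
    have : C₀ * (L + 1) ≤ C₀ * (16 * q) := Nat.mul_le_mul_left _ (by omega)
    nlinarith
  have h1 : (C₀ * (L + 1) + c) ^ c ≤ (16 * C₀ + c) ^ c * q ^ c := by
    rw [← mul_pow]; exact Nat.pow_le_pow_left hbase c
  have h2 : 2 * L + 4 ≤ 34 * q := by omega
  have hqc : q ^ c ≤ q ^ (c + 1) := Nat.pow_le_pow_right hq1 (by omega)
  have hq' : q ≤ q ^ (c + 1) := by
    calc q = q ^ 1 := (pow_one q).symm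
      _ ≤ q ^ (c + 1) := Nat.pow_le_pow_right hq1 (by omega)
  have h3 : (C₀ * (L + 1) + c) ^ c + 2 * L + 4 ≤ K * q ^ (c + 1) := by
    calc (C₀ * (L + 1) + c) ^ c + 2 * L + 4
        ≤ (16 * C₀ + c) ^ c * q ^ c + 34 * q := by omega
      _ ≤ (16 * C₀ + c) ^ c * q ^ (c + 1) + 34 * q ^ (c + 1) :=
          Nat.add_le_add (Nat.mul_le_mul_left _ hqc) (Nat.mul_le_mul_left _ hq')
      _ = K * q ^ (c + 1) := by rw [hK]; ring
  have h4 : K * q ^ (c + 1) ≤ q ^ (c + 2) := by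
    calc K * q ^ (c + 1) ≤ q * q ^ (c + 1) := Nat.mul_le_mul_right _ hqK
      _ = q ^ (c + 2) := by ring
  have h5 : q ^ (c + 2) < 2 ^ q :=
    Summit.ValiantsHypothesis.ValiantsHypothesis.Theorems.BarrierLever.SigmaLambdaSigmaSlice.pow_lt_two_pow_of_le
      (c + 2) q hq4
  omega

/-- **The asymptotic comparison.**  For every `c, C₀` and all large `m`: for every `n ≤ m^{C₀}`,
`2^{(log₂ n + c)^c} + 2 m² < 2^{m^{1/8}}` (as real numbers). [folklore] -/
theorem two_pow_polylog_add_lt (c C₀ : ℕ) :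
    ∃ M : ℕ, ∀ m ≥ M, ∀ n ≤ m ^ C₀,
      ((2 ^ ((Nat.log 2 n + c) ^ c) + 2 * m ^ 2 : ℕ) : ℝ) < (2 : ℝ) ^ ((m : ℝ) ^ (1 / 8 : ℝ)) := by
  obtain ⟨Q, hQ⟩ := polylog_exponent_le_two_pow c C₀
  refine ⟨2 ^ (8 * Q), fun m hm n hn => ?_⟩
  have hm0 : m ≠ 0 := by have := Nat.one_le_two_pow (n := 8 * Q); omega
  set L : ℕ := Nat.log 2 m with hL
  set q : ℕ := L / 8 with hq
  have hLq : L ≤ 8 * q + 7 := by omega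
  have hQq : Q ≤ q := by
    have : 8 * Q ≤ L := Nat.le_log_of_pow_le (by norm_num) hm
    omega
  -- `log₂ n ≤ C₀ (L + 1)`
  have hmL : m < 2 ^ (L + 1) := Nat.lt_pow_succ_log_self (by norm_num) m
  have hlogn : Nat.log 2 n ≤ C₀ * (L + 1) := by
    have hn' : n ≤ 2 ^ (C₀ * (L + 1)) := by
      calc n ≤ m ^ C₀ := hn
        _ ≤ (2 ^ (L + 1)) ^ C₀ := Nat.pow_le_pow_left hmL.le C₀
        _ = 2 ^ (C₀ * (L + 1)) := by rw [← pow_mul, mul_comm]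
    calc Nat.log 2 n ≤ Nat.log 2 (2 ^ (C₀ * (L + 1))) := Nat.log_mono_right hn'
      _ = C₀ * (L + 1) := Nat.log_pow (by norm_num) _
  -- the natural-number exponent `T`
  set T : ℕ := (C₀ * (L + 1) + c) ^ c + 2 * L + 4 with hT
  have hTq : T ≤ 2 ^ q := hQ q hQq L hLq
  have hA : (Nat.log 2 n + c) ^ c ≤ (C₀ * (L + 1) + c) ^ c := Nat.pow_le_pow_left (by omega) c
  have hm2 : 2 * m ^ 2 < 2 ^ (2 * L + 3) := by
    have h : m ^ 2 < 2 ^ ((L + 1) * 2) := by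
      rw [pow_mul]; exact Nat.pow_lt_pow_left hmL (by norm_num)
    have h' : 2 ^ (2 * L + 3) = 2 * 2 ^ ((L + 1) * 2) := by
      rw [show 2 * L + 3 = ((L + 1) * 2) + 1 by ring, pow_succ]; ring
    rw [h']; omega
  have hsum : 2 ^ ((Nat.log 2 n + c) ^ c) + 2 * m ^ 2 < 2 ^ T := by
    have e1 : 2 ^ ((Nat.log 2 n + c) ^ c) ≤ 2 ^ (T - 1) :=
      Nat.pow_le_pow_right (by norm_num) (by omega)
    have e2 : 2 ^ (2 * L + 3) ≤ 2 ^ (T - 1) := Nat.pow_le_pow_right (by norm_num) (by omega)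
    have e3 : 2 ^ (T - 1) * 2 = 2 ^ T := by
      rw [← pow_succ, Nat.sub_add_cancel (by omega : 1 ≤ T)]
    omega
  -- `2^q ≤ m^{1/8}` since `(2^q)^8 ≤ 2^L ≤ m`
  have h8 : (2 ^ q) ^ 8 ≤ m := by
    rw [← pow_mul]
    exact le_trans (Nat.pow_le_pow_right (by norm_num) (by omega)) (Nat.pow_log_le_self 2 hm0)
  have hroot : ((2 ^ q : ℕ) : ℝ) ≤ (m : ℝ) ^ (1 / 8 : ℝ) := by
    have h8' : (((2 ^ q : ℕ) : ℝ)) ^ (8 : ℕ) ≤ (m : ℝ) := by exact_mod_cast h8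
    calc ((2 ^ q : ℕ) : ℝ) = ((((2 ^ q : ℕ) : ℝ)) ^ (8 : ℕ)) ^ ((8 : ℕ) : ℝ)⁻¹ :=
        (Real.pow_rpow_inv_natCast (Nat.cast_nonneg _) (by norm_num)).symm
      _ ≤ (m : ℝ) ^ ((8 : ℕ) : ℝ)⁻¹ := Real.rpow_le_rpow (by positivity) h8' (by positivity)
      _ = (m : ℝ) ^ (1 / 8 : ℝ) := by norm_num
  have hTr : (T : ℝ) ≤ (m : ℝ) ^ (1 / 8 : ℝ) := le_trans (by exact_mod_cast hTq) hroot
  calc ((2 ^ ((Nat.log 2 n + c) ^ c) + 2 * m ^ 2 : ℕ) : ℝ) < ((2 ^ T : ℕ) : ℝ) := by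
        exact_mod_cast hsum
    _ = (2 : ℝ) ^ (T : ℝ) := by rw [Real.rpow_natCast]; push_cast; ring
    _ ≤ (2 : ℝ) ^ ((m : ℝ) ^ (1 / 8 : ℝ)) :=
        Real.rpow_le_rpow_of_exponent_le (by norm_num) hTr

/-! ### Stub A from a clique-like monotone projection -/

/-- **The `circuitSizeOver` form of stub A from a clique-like monotone projection.**  Suppose that
for some `C₀` and all large `n` there are `m` with `n ≤ m^{C₀}` and a projection
`e : σ n → KEdge m ⊕ Bool` (every arc variable of `[2n]` becomes an edge variable of `K_m` or a
constant) under which nest-free perfect-matching existence ACCEPTS the clique vector of every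
`⌊√m⌋`-set and REJECTS the colouring vector of every `(⌊√m⌋ - 1)`-colouring.  Then, for every `c`,
eventually every `{∧₂, ∨₂}`-circuit for nest-free perfect-matching existence on `[2n]` has more
than `2^((log₂ n + c)^c)` gates: the projected circuit (`exists_monotoneCircuit_projection`,
`+ 2·|E(K_m)|` gates) computes a `(⌊√m⌋ - 1, ⌊√m⌋)`-clique function, which needs `2^{m^{1/8}}`
gates (`cliqueSqrt_monotone_lowerBound`), and `2^((log₂ n + c)^c) + 2m² < 2^{m^{1/8}}`.
[cite: AlonBoppana1987, Lemma 3.14] [cite: Jukna2012, Thm. 9.26 (PDF p. 283)] -/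
theorem circuitSizeOver_lowerBound_of_cliqueProjection (C₀ : ℕ)
    (hP : ∃ n₀ : ℕ, ∀ n ≥ n₀, ∃ m : ℕ, n ≤ m ^ C₀ ∧ ∃ e : σ n → KEdge m ⊕ Bool,
      (∀ Z : Finset (Fin m), Z.card = Nat.sqrt m →
        decide (SuppFn (NN n) (Finset.univ.filter fun a : σ n =>
          Sum.elim (cliqueVec Z) id (e a) = true)) = true) ∧
      (∀ O : Fin m → Fin (Nat.sqrt m - 1),
        decide (SuppFn (NN n) (Finset.univ.filter fun a : σ n =>
          Sum.elim (colorVec O) id (e a) = true)) = false)) :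
    ∀ c : ℕ, ∃ n₀ : ℕ, ∀ n ≥ n₀, 2 ^ ((Nat.log 2 n + c) ^ c) <
      circuitSizeOver monotoneBasis
        (fun x : σ n → Bool => decide (SuppFn (NN n) (Finset.univ.filter fun e => x e = true))) := by
  intro c
  obtain ⟨n₀, hn₀⟩ := hP
  obtain ⟨M₀, hM₀⟩ := eventually_atTop.1 cliqueSqrt_monotone_lowerBound
  obtain ⟨M₁, hM₁⟩ := two_pow_polylog_add_lt c C₀
  set M : ℕ := max (max M₀ M₁) 4 with hM
  refine ⟨max (max n₀ 2) (M ^ C₀), fun n hn => ?_⟩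
  have hnn₀ : n₀ ≤ n := le_trans (le_max_left _ _) (le_trans (le_max_left _ _) hn)
  have hn2 : 2 ≤ n := le_trans (le_max_right _ _) (le_trans (le_max_left _ _) hn)
  have hnM : M ^ C₀ ≤ n := le_trans (le_max_right _ _) hn
  obtain ⟨m, hnm, e, hacc, hrej⟩ := hn₀ n hnn₀
  -- `m ≥ M` (if `C₀ = 0` the hypothesis is absurd for `n ≥ 2`)
  have hmM : M ≤ m := by
    by_contra hlt
    push Not at hlt
    rcases Nat.eq_zero_or_pos C₀ with hC | hC
    · subst hC; simp at hnm; omega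
    · have : m ^ C₀ < M ^ C₀ := Nat.pow_lt_pow_left hlt (by omega)
      omega
  have hmM₀ : M₀ ≤ m := le_trans (le_trans (le_max_left _ _) (le_max_left _ _)) hmM
  have hmM₁ : M₁ ≤ m := le_trans (le_trans (le_max_right _ _) (le_max_left _ _)) hmM
  have hm4 : 4 ≤ m := le_trans (le_max_right _ _) hmM
  have hsqrt2 : 2 ≤ Nat.sqrt m := by
    rw [Nat.le_sqrt]; omega
  -- the positive and negative witnesses exist
  obtain ⟨Z, -, hZ⟩ := Finset.exists_subset_card_eq
    (s := (Finset.univ : Finset (Fin m))) (n := Nat.sqrt m) (by simpa using Nat.sqrt_le_self m)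
  let O : Fin m → Fin (Nat.sqrt m - 1) := fun _ => ⟨0, by omega⟩
  -- the NFPM function and the projected (clique-like) function
  set F : (σ n → Bool) → Bool :=
    fun x => decide (SuppFn (NN n) (Finset.univ.filter fun e => x e = true)) with hF
  have hFmono : Monotone F := nfpmExists_monotone n
  -- every monotone circuit for `F` is large
  have hall : ∀ D : Circuit (σ n), D.IsOver monotoneBasis → D.Computes F →
      2 ^ ((Nat.log 2 n + c) ^ c) + 1 ≤ D.size := by
    intro D hDB hDF
    have htop : D.eval (fun a => Sum.elim (fun _ : KEdge m => true) id (e a)) = true := by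
      rw [hDF]
      have hle : (fun a => Sum.elim (cliqueVec Z) id (e a)) ≤
          (fun a => Sum.elim (fun _ : KEdge m => true) id (e a)) := by
        intro a
        show Sum.elim (cliqueVec Z) id (e a) ≤ Sum.elim (fun _ : KEdge m => true) id (e a)
        cases e a with
        | inl v => exact Bool.le_true _
        | inr b => exact le_rfl
      have h2 : decide (SuppFn (NN n) (Finset.univ.filter fun a : σ n =>
            Sum.elim (cliqueVec Z) id (e a) = true)) ≤
          decide (SuppFn (NN n) (Finset.univ.filter fun a : σ n =>
            Sum.elim (fun _ : KEdge m => true) id (e a) = true)) := hFmono hle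
      rw [hacc Z hZ] at h2
      exact Bool.eq_true_of_true_le h2
    have hbot : D.eval (fun a => Sum.elim (fun _ : KEdge m => false) id (e a)) = false := by
      rw [hDF]
      have hle : (fun a => Sum.elim (fun _ : KEdge m => false) id (e a)) ≤
          (fun a => Sum.elim (colorVec O) id (e a)) := by
        intro a
        show Sum.elim (fun _ : KEdge m => false) id (e a) ≤ Sum.elim (colorVec O) id (e a)
        cases e a with
        | inl v => exact Bool.false_le _
        | inr b => exact le_rfl
      have h2 : decide (SuppFn (NN n) (Finset.univ.filter fun a : σ n =>
            Sum.elim (fun _ : KEdge m => false) id (e a) = true)) ≤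
          decide (SuppFn (NN n) (Finset.univ.filter fun a : σ n =>
            Sum.elim (colorVec O) id (e a) = true)) := hFmono hle
      rw [hrej O] at h2
      exact Bool.eq_false_of_le_false h2
    obtain ⟨D', hD'B, hD's, hD'ev⟩ := exists_monotoneCircuit_projection D hDB e htop hbot
    have hD'F : D'.Computes (fun y : KEdge m → Bool => F (fun a => Sum.elim y id (e a))) := by
      intro y
      rw [hD'ev y, hDF]
    have hbound := hM₀ m hmM₀ (fun y : KEdge m → Bool => F (fun a => Sum.elim y id (e a)))
      (fun Z' hZ' => hacc Z' hZ') (fun O' => hrej O') D' hD'B hD'F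
    have hlt := hM₁ m hmM₁ n hnm
    have hcard := card_KEdge_le m
    have hreal : ((2 ^ ((Nat.log 2 n + c) ^ c) + 2 * m ^ 2 : ℕ) : ℝ) <
        ((D.size + 2 * m ^ 2 : ℕ) : ℝ) := by
      calc ((2 ^ ((Nat.log 2 n + c) ^ c) + 2 * m ^ 2 : ℕ) : ℝ)
          < (2 : ℝ) ^ ((m : ℝ) ^ (1 / 8 : ℝ)) := hlt
        _ ≤ (D'.size : ℝ) := hbound
        _ ≤ ((D.size + 2 * m ^ 2 : ℕ) : ℝ) := by
            exact_mod_cast hD's.trans (by omega)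
    have hnat : 2 ^ ((Nat.log 2 n + c) ^ c) + 2 * m ^ 2 < D.size + 2 * m ^ 2 := by
      exact_mod_cast hreal
    omega
  exact le_circuitSizeOver_of_forall (exists_monotoneCircuit_nfpm n (by omega)) hall

/-- **Stub A (`stub_supportFnHard`) VERBATIM from a clique-like monotone projection** of nest-free
perfect-matching existence (`circuitSizeOver_lowerBound_of_cliqueProjection` ∘
`supportFnHard_of_circuitSizeOver_lowerBound`).  The remaining task of the line on stub A is
therefore a GADGET: a polynomial-size monotone projection of NFPM-existence on `[2n]` onto a
`(⌊√m⌋ - 1, ⌊√m⌋)`-clique function of `K_m`, `n ≤ m^{C₀}`. [folklore] -/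
theorem supportFnHard_of_cliqueProjection (C₀ : ℕ)
    (hP : ∃ n₀ : ℕ, ∀ n ≥ n₀, ∃ m : ℕ, n ≤ m ^ C₀ ∧ ∃ e : σ n → KEdge m ⊕ Bool,
      (∀ Z : Finset (Fin m), Z.card = Nat.sqrt m →
        decide (SuppFn (NN n) (Finset.univ.filter fun a : σ n =>
          Sum.elim (cliqueVec Z) id (e a) = true)) = true) ∧
      (∀ O : Fin m → Fin (Nat.sqrt m - 1),
        decide (SuppFn (NN n) (Finset.univ.filter fun a : σ n =>
          Sum.elim (colorVec O) id (e a) = true)) = false)) :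
    ∀ k c : ℕ, ∃ n₀ : ℕ, ∀ n ≥ n₀, ∀ T : Finset (σ n), T.card ≤ (Nat.log 2 n + k) ^ k →
      ∀ g : MvPolynomial (σ n) ℝ≥0, (∀ A : Finset (σ n), SuppFn g A ↔ SuppFn (freeVars T (NN n)) A) →
        2 ^ ((Nat.log 2 n + c) ^ c) < complexity g :=
  supportFnHard_of_circuitSizeOver_lowerBound (circuitSizeOver_lowerBound_of_cliqueProjection C₀ hP)

end Summit.ValiantsHypothesis.ValiantsHypothesis.Theorems.FifoMatching.NNNotVP.DivisionSplit

end
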